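import Summits.Ventures.PercRepro.RankLevelSetTriangleStar
import Summits.Ventures.PercRepro.RankLevelSetPlaneSix

/-!
# PercRepro — LEMMA W: the four-circuit count by the size of the ground set, `8·s₄ ≤ n(n−1)(n−2)` under (C2)
(p2, gen 18)

Under (C2) alone (rank-`≤ 3` sets have `≤ 6` points) a finite matroid on `n` points has at most `n(n−1)(n−2)/8`
circuits with four elements — tight on `U_{3,6}` (`n = 6`, `s₄ = 15`). Against the nullity bounds at the cells of
the `q = 4` window this is a bound in `n = p + d`: `4488` at `n = 34` where the chain's `fourCircuitBound 26` is
`4823`; with LEMMA V's `s₃ ≤ 128` it closes the cell `(8, 26)` (twin `1.0233 → 0.9892`).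

THE ARGUMENT (a triple double count). Three distinct points `a, b, c` lie in at most `3` four-circuits: the fourth
point `d` of such a circuit lies in `cl {a, b, c}` (a circuit lies in the closure of its other points), a set of
rank `≤ 3` with `≤ 6` points by (C2), outside `{a, b, c}`; and `d` determines the circuit. Hence, for two distinct
points `a, b`, counting the pairs (four-circuit `C ∋ a, b`; point `c ∈ C`) two ways, `4·#{C ∋ a, b} = 2·#{C ∋ a, b} +
Σ_{c ≠ a, b} #{C ∋ a, b, c} ≤ 2·#{C ∋ a, b} + 3(n − 2)`, i.e. `2·#{C ∋ a, b} ≤ 3(n − 2)`; then for one point `a`,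
`3·#{C ∋ a} = Σ_{b ≠ a} #{C ∋ a, b}` gives `2·#{C ∋ a} ≤ (n − 1)(n − 2)`; and `4·s₄ = Σ_a #{C ∋ a}` gives
`8·s₄ ≤ n(n − 1)(n − 2)`.

* `fourCircuits M` — the circuits with four elements; `sum_card_filter_mem` — the double count for `k`-sets;
* `card_filter_fourCircuits_three_le` — at most `3` four-circuits through three points;
* `two_mul_card_filter_fourCircuits_pair_le` — `2·#{C ∋ a, b} ≤ 3(n − 2)`;
* `two_mul_card_filter_fourCircuits_point_le` — `2·#{C ∋ a} ≤ (n − 1)(n − 2)`;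
* **`eight_mul_ncard_fourCircuits_le`** — `8·s₄ ≤ n(n − 1)(n − 2)` under (C2); `ncard_fourCircuits_le_mul_div`;
* **`core_eight_mul_ncard_fourCircuits_le`**, **`core_ncard_fourCircuits_le_mul_div`** — on the `e`-free core.
Axioms: standard.
-/

open scoped Matroid

namespace PercRepro

namespace S1

open Set

variable {α : Type}

/-- The four-circuits of `M`: the circuits with exactly `4` elements. -/
def fourCircuits (M : Matroid α) : Set (Set α) := {C : Set α | M.IsCircuit C ∧ C.ncard = 4}

/-- The four-circuits of a finite matroid form a finite set. -/
theorem finite_fourCircuits (M : Matroid α) [M.Finite] : (fourCircuits M).Finite :=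
  M.ground_finite.finite_subsets.subset (fun _ hC => hC.1.subset_ground)

open Classical in
/-- **Double count**: for a finite family `F` of `k`-element subsets of `E`, `Σ_{x ∈ E} #{C ∈ F : x ∈ C} = k·|F|`. -/
theorem sum_card_filter_mem (M : Matroid α) [M.Finite] (F : Finset (Set α)) (k : ℕ)
    (hF : ∀ C ∈ F, C ⊆ M.E ∧ C.ncard = k) :
    ∑ x ∈ M.ground_finite.toFinset, (F.filter (fun C => x ∈ C)).card = k * F.card := by
  classical
  calc ∑ x ∈ M.ground_finite.toFinset, (F.filter (fun C => x ∈ C)).card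
      = ∑ x ∈ M.ground_finite.toFinset, ∑ C ∈ F, (if x ∈ C then 1 else 0) := by
        apply Finset.sum_congr rfl
        intro x _
        rw [Finset.card_filter]
    _ = ∑ C ∈ F, ∑ x ∈ M.ground_finite.toFinset, (if x ∈ C then 1 else 0) := Finset.sum_comm
    _ = ∑ _C ∈ F, k := by
        apply Finset.sum_congr rfl
        intro C hC
        rw [Finset.sum_boole, Nat.cast_id]
        have hCE := (hF C hC).1
        have hCfin : C.Finite := M.ground_finite.subset hCE
        have hfilter : (M.ground_finite.toFinset.filter (fun x => x ∈ C)) = hCfin.toFinset := by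
          ext x
          simp only [Finset.mem_filter, Set.Finite.mem_toFinset]
          constructor
          · rintro ⟨-, hx⟩
            exact hx
          · intro hx
            exact ⟨hCE hx, hx⟩
        rw [hfilter, ← Set.ncard_eq_toFinset_card C hCfin, (hF C hC).2]
    _ = k * F.card := by rw [Finset.sum_const, smul_eq_mul, mul_comm]

open Classical in
/-- **At most three four-circuits through three given points** (under (C2)): the fourth point lies in the plane
`cl {a, b, c}`, which has `≤ 6` points, outside `{a, b, c}`, and determines the circuit. -/
theorem card_filter_fourCircuits_three_le (M : Matroid α) [M.Finite]
    (hC2 : ∀ P ⊆ M.E, M.eRk P ≤ 3 → P.ncard ≤ 6) {a b c : α} (haE : a ∈ M.E) (hbE : b ∈ M.E)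
    (hcE : c ∈ M.E) (hab : a ≠ b) (hac : a ≠ c) (hbc : b ≠ c) :
    ((finite_fourCircuits M).toFinset.filter (fun C => (a ∈ C ∧ b ∈ C) ∧ c ∈ C)).card ≤ 3 := by
  classical
  set X : Set α := {a, b, c} with hX
  have hXE : X ⊆ M.E := by
    intro z hz
    rcases hz with rfl | rfl | rfl
    exacts [haE, hbE, hcE]
  have haX : a ∉ ({b, c} : Set α) := by simp [hab, hac]
  have hXcard : X.ncard = 3 := by
    rw [hX, Set.ncard_insert_of_notMem haX, Set.ncard_pair hbc]
  have hXfin : X.Finite := M.ground_finite.subset hXE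
  have hclE : M.closure X ⊆ M.E := M.closure_subset_ground X
  have hclfin : (M.closure X).Finite := M.ground_finite.subset hclE
  have hclr : M.eRk (M.closure X) ≤ 3 := by
    rw [M.eRk_closure_eq]
    calc M.eRk X ≤ X.encard := M.eRk_le_encard X
      _ = ((X.ncard : ℕ) : ℕ∞) := by rw [hXfin.cast_ncard_eq]
      _ = 3 := by rw [hXcard]; rfl
  have hcl6 : (M.closure X).ncard ≤ 6 := hC2 _ hclE hclr
  have hXcl : X ⊆ M.closure X := M.subset_closure X hXE
  have hT : (M.closure X \ X).ncard ≤ 3 := by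
    rw [Set.ncard_sdiff' hXcl hclfin, hXcard]
    omega
  have hTfin : (M.closure X \ X).Finite := hclfin.subset Set.sdiff_subset
  have hTcard : hTfin.toFinset.card = (M.closure X \ X).ncard := (Set.ncard_eq_toFinset_card _ _).symm
  refine (Finset.card_le_card_of_surjOn (fun d => insert d X) ?_).trans (by rw [hTcard]; exact hT)
  intro C hC
  rw [Finset.mem_coe, Finset.mem_filter, Set.Finite.mem_toFinset] at hC
  obtain ⟨⟨hCc, hC4⟩, ⟨haC, hbC⟩, hcC⟩ := hC
  have hXC : X ⊆ C := by
    intro z hz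
    rcases hz with rfl | rfl | rfl
    exacts [haC, hbC, hcC]
  have hCfin : C.Finite := M.ground_finite.subset hCc.subset_ground
  obtain ⟨d, hdC, hdX⟩ : ∃ d, d ∈ C ∧ d ∉ X :=
    Set.exists_mem_notMem_of_ncard_lt_ncard (by rw [hXcard, hC4]; norm_num) hXfin
  have hCeq : insert d X = C := by
    refine Set.eq_of_subset_of_ncard_le (Set.insert_subset hdC hXC) ?_ hCfin
    rw [hC4, Set.ncard_insert_of_notMem hdX hXfin, hXcard]
  refine ⟨d, ?_, hCeq⟩
  rw [Finset.mem_coe, Set.Finite.mem_toFinset]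
  refine ⟨?_, hdX⟩
  have h := hCc.mem_closure_sdiff_singleton_of_mem hdC
  have hsub : C \ {d} ⊆ X := by
    intro z hz
    rw [← hCeq] at hz
    obtain ⟨hz1, hz2⟩ := hz
    rcases hz1 with rfl | hz1
    · exact (hz2 (Set.mem_singleton _)).elim
    · exact hz1
  exact M.closure_subset_closure hsub h

open Classical in
/-- **`2·#{C ∋ a, b} ≤ 3(n − 2)`** for distinct points `a, b` (under (C2)): the four-circuits through `a` and
`b`, counted with their third points. -/
theorem two_mul_card_filter_fourCircuits_pair_le (M : Matroid α) [M.Finite]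
    (hC2 : ∀ P ⊆ M.E, M.eRk P ≤ 3 → P.ncard ≤ 6) {a b : α} (haE : a ∈ M.E) (hbE : b ∈ M.E) (hab : a ≠ b) :
    2 * ((finite_fourCircuits M).toFinset.filter (fun C => a ∈ C ∧ b ∈ C)).card ≤ 3 * (M.E.ncard - 2) := by
  classical
  have hmemE : ∀ x, x ∈ M.ground_finite.toFinset ↔ x ∈ M.E := fun x => Set.Finite.mem_toFinset _
  have hEcard : M.ground_finite.toFinset.card = M.E.ncard := (Set.ncard_eq_toFinset_card _ _).symm
  set G := (finite_fourCircuits M).toFinset.filter (fun C => a ∈ C ∧ b ∈ C) with hG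
  have hGmem : ∀ C ∈ G, C ⊆ M.E ∧ C.ncard = 4 := by
    intro C hC
    rw [hG, Finset.mem_filter, Set.Finite.mem_toFinset] at hC
    exact ⟨hC.1.1.subset_ground, hC.1.2⟩
  have hsum := sum_card_filter_mem M G 4 hGmem
  have haEf : a ∈ M.ground_finite.toFinset := (hmemE a).2 haE
  have hbEf : b ∈ M.ground_finite.toFinset.erase a := Finset.mem_erase.2 ⟨hab.symm, (hmemE b).2 hbE⟩
  have h1 : ∑ x ∈ M.ground_finite.toFinset, (G.filter (fun C => x ∈ C)).card =
      (G.filter (fun C => a ∈ C)).card +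
        ∑ x ∈ M.ground_finite.toFinset.erase a, (G.filter (fun C => x ∈ C)).card :=
    (Finset.add_sum_erase _ (fun x => (G.filter (fun C => x ∈ C)).card) haEf).symm
  have h2 : ∑ x ∈ M.ground_finite.toFinset.erase a, (G.filter (fun C => x ∈ C)).card =
      (G.filter (fun C => b ∈ C)).card +
        ∑ x ∈ (M.ground_finite.toFinset.erase a).erase b, (G.filter (fun C => x ∈ C)).card :=
    (Finset.add_sum_erase _ (fun x => (G.filter (fun C => x ∈ C)).card) hbEf).symm
  have hGa : (G.filter (fun C => a ∈ C)).card = G.card := by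
    rw [Finset.filter_true_of_mem]
    intro C hC
    rw [hG, Finset.mem_filter] at hC
    exact hC.2.1
  have hGb : (G.filter (fun C => b ∈ C)).card = G.card := by
    rw [Finset.filter_true_of_mem]
    intro C hC
    rw [hG, Finset.mem_filter] at hC
    exact hC.2.2
  rw [h1, h2, hGa, hGb] at hsum
  have hrest : ∑ c ∈ (M.ground_finite.toFinset.erase a).erase b, (G.filter (fun C => c ∈ C)).card ≤
      ∑ _c ∈ (M.ground_finite.toFinset.erase a).erase b, 3 := by
    apply Finset.sum_le_sum
    intro c hc
    rw [Finset.mem_erase, Finset.mem_erase] at hc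
    obtain ⟨hcb, hca, hcE⟩ := hc
    rw [hG, Finset.filter_filter]
    exact card_filter_fourCircuits_three_le M hC2 haE hbE ((hmemE c).1 hcE) hab (Ne.symm hca) (Ne.symm hcb)
  rw [Finset.sum_const, smul_eq_mul, Finset.card_erase_of_mem hbEf, Finset.card_erase_of_mem haEf,
    hEcard] at hrest
  omega

open Classical in
/-- **`2·#{C ∋ a} ≤ (n − 1)(n − 2)`** for a point `a` (under (C2)): the four-circuits through `a`, counted with
their second points. -/
theorem two_mul_card_filter_fourCircuits_point_le (M : Matroid α) [M.Finite]
    (hC2 : ∀ P ⊆ M.E, M.eRk P ≤ 3 → P.ncard ≤ 6) {a : α} (haE : a ∈ M.E) :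
    2 * ((finite_fourCircuits M).toFinset.filter (fun C => a ∈ C)).card ≤
      (M.E.ncard - 1) * (M.E.ncard - 2) := by
  classical
  have hmemE : ∀ x, x ∈ M.ground_finite.toFinset ↔ x ∈ M.E := fun x => Set.Finite.mem_toFinset _
  have hEcard : M.ground_finite.toFinset.card = M.E.ncard := (Set.ncard_eq_toFinset_card _ _).symm
  set H := (finite_fourCircuits M).toFinset.filter (fun C => a ∈ C) with hH
  have hHmem : ∀ C ∈ H, C ⊆ M.E ∧ C.ncard = 4 := by
    intro C hC
    rw [hH, Finset.mem_filter, Set.Finite.mem_toFinset] at hC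
    exact ⟨hC.1.1.subset_ground, hC.1.2⟩
  have hsum := sum_card_filter_mem M H 4 hHmem
  have haEf : a ∈ M.ground_finite.toFinset := (hmemE a).2 haE
  have h1 : ∑ x ∈ M.ground_finite.toFinset, (H.filter (fun C => x ∈ C)).card =
      (H.filter (fun C => a ∈ C)).card +
        ∑ x ∈ M.ground_finite.toFinset.erase a, (H.filter (fun C => x ∈ C)).card :=
    (Finset.add_sum_erase _ (fun x => (H.filter (fun C => x ∈ C)).card) haEf).symm
  have hHa : (H.filter (fun C => a ∈ C)).card = H.card := by
    rw [Finset.filter_true_of_mem]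
    intro C hC
    rw [hH, Finset.mem_filter] at hC
    exact hC.2
  rw [h1, hHa] at hsum
  have hrest : ∑ b ∈ M.ground_finite.toFinset.erase a, 2 * (H.filter (fun C => b ∈ C)).card ≤
      ∑ _b ∈ M.ground_finite.toFinset.erase a, 3 * (M.E.ncard - 2) := by
    apply Finset.sum_le_sum
    intro b hb
    rw [Finset.mem_erase] at hb
    obtain ⟨hba, hbE⟩ := hb
    rw [hH, Finset.filter_filter]
    exact two_mul_card_filter_fourCircuits_pair_le M hC2 haE ((hmemE b).1 hbE) (Ne.symm hba)
  rw [← Finset.mul_sum, Finset.sum_const, smul_eq_mul, Finset.card_erase_of_mem haEf, hEcard] at hrest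
  -- hsum : H.card + Σ_{b ≠ a} … = 4 * H.card ; hrest : 2 * Σ_{b ≠ a} … ≤ (n - 1) * (3 * (n - 2))
  have h3 : 3 * (2 * H.card) ≤ 3 * ((M.E.ncard - 1) * (M.E.ncard - 2)) := by
    calc 3 * (2 * H.card) = 2 * (3 * H.card) := by ring
      _ = 2 * ∑ x ∈ M.ground_finite.toFinset.erase a, (H.filter (fun C => x ∈ C)).card := by omega
      _ ≤ (M.E.ncard - 1) * (3 * (M.E.ncard - 2)) := hrest
      _ = 3 * ((M.E.ncard - 1) * (M.E.ncard - 2)) := by ring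
  exact Nat.le_of_mul_le_mul_left h3 (by norm_num)

/-- **LEMMA W**: under (C2), `8·s₄ ≤ n(n − 1)(n − 2)` — the four-circuits by the size of the ground set. -/
theorem eight_mul_ncard_fourCircuits_le (M : Matroid α) [M.Finite]
    (hC2 : ∀ P ⊆ M.E, M.eRk P ≤ 3 → P.ncard ≤ 6) :
    8 * (fourCircuits M).ncard ≤ M.E.ncard * (M.E.ncard - 1) * (M.E.ncard - 2) := by
  classical
  have hmemE : ∀ x, x ∈ M.ground_finite.toFinset ↔ x ∈ M.E := fun x => Set.Finite.mem_toFinset _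
  have hEcard : M.ground_finite.toFinset.card = M.E.ncard := (Set.ncard_eq_toFinset_card _ _).symm
  have hF4 : (fourCircuits M).ncard = (finite_fourCircuits M).toFinset.card :=
    Set.ncard_eq_toFinset_card _ _
  have hsum := sum_card_filter_mem M (finite_fourCircuits M).toFinset 4 (fun C hC => by
    rw [Set.Finite.mem_toFinset] at hC
    exact ⟨hC.1.subset_ground, hC.2⟩)
  have hle : ∑ a ∈ M.ground_finite.toFinset, 2 * ((finite_fourCircuits M).toFinset.filter (fun C => a ∈ C)).card ≤
      ∑ _a ∈ M.ground_finite.toFinset, (M.E.ncard - 1) * (M.E.ncard - 2) :=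
    Finset.sum_le_sum (fun a ha => two_mul_card_filter_fourCircuits_point_le M hC2 ((hmemE a).1 ha))
  rw [← Finset.mul_sum, hsum, Finset.sum_const, smul_eq_mul, hEcard] at hle
  rw [hF4]
  calc 8 * (finite_fourCircuits M).toFinset.card = 2 * (4 * (finite_fourCircuits M).toFinset.card) := by ring
    _ ≤ M.E.ncard * ((M.E.ncard - 1) * (M.E.ncard - 2)) := hle
    _ = M.E.ncard * (M.E.ncard - 1) * (M.E.ncard - 2) := by ring

/-- **LEMMA W, the cap**: `s₄ ≤ ⌊n(n − 1)(n − 2)/8⌋` under (C2). -/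
theorem ncard_fourCircuits_le_mul_div (M : Matroid α) [M.Finite]
    (hC2 : ∀ P ⊆ M.E, M.eRk P ≤ 3 → P.ncard ≤ 6) :
    (fourCircuits M).ncard ≤ M.E.ncard * (M.E.ncard - 1) * (M.E.ncard - 2) / 8 := by
  rw [Nat.le_div_iff_mul_le (by norm_num), mul_comm]
  exact eight_mul_ncard_fourCircuits_le M hC2

/-- **LEMMA W on the `e`-free core**, in the set-builder vocabulary of `S1RowTwelve`: `8·s₄ ≤ n(n − 1)(n − 2)`. -/
theorem core_eight_mul_ncard_fourCircuits_le (M : Matroid α) [M.Finite]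
    (hfree : ∀ e ∈ M.E, ∃ A ⊆ M.E \ {e}, e ∉ M.closure A ∧ e ∉ M.closure ((M.E \ {e}) \ A)) :
    8 * {C : Set α | M.IsCircuit C ∧ C.ncard = 4}.ncard ≤ M.E.ncard * (M.E.ncard - 1) * (M.E.ncard - 2) := by
  have hplane : ∀ P ⊆ M.E, M.eRk P ≤ 3 → P.ncard ≤ 6 := fun P hP hr =>
    ThmN.ncard_le_six_of_eRk_le_three_of_free M hfree hP hr
  exact eight_mul_ncard_fourCircuits_le M hplane

/-- **LEMMA W on the `e`-free core, the cap**: `s₄ ≤ ⌊n(n − 1)(n − 2)/8⌋`. -/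
theorem core_ncard_fourCircuits_le_mul_div (M : Matroid α) [M.Finite]
    (hfree : ∀ e ∈ M.E, ∃ A ⊆ M.E \ {e}, e ∉ M.closure A ∧ e ∉ M.closure ((M.E \ {e}) \ A)) :
    {C : Set α | M.IsCircuit C ∧ C.ncard = 4}.ncard ≤ M.E.ncard * (M.E.ncard - 1) * (M.E.ncard - 2) / 8 := by
  rw [Nat.le_div_iff_mul_le (by norm_num), mul_comm]
  exact core_eight_mul_ncard_fourCircuits_le M hfree

end S1

end PercRepro
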